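import Summits.QuantumFields.BalabanUV.Beta.EriceRemainderEnclosureHistoryAutonomyComparisonAgeCompositionTwoAgesOldRead
import Summits.QuantumFields.BalabanUV.Beta.EriceRemainderEnclosureHistoryAutonomyComparisonAgeCompositionUpwardChain

/-!
# EriceRemainderEnclosureHistoryAutonomyComparisonAgeCompositionUpwardChainFlow — (E98b) route (N), first order, ALONG THE FLOW: the upward chain of
# (E98a) for the flow's kernels.  §1 the DAMPED aggregate kernel is brought to tail form by the weights `Γ_q = Π_{t<q} g_t`: `y_q = ε_q∕Γ_q` solves a
# tail-kernel system with `A′_m(l) = Σ_{k>l} c_k(m)·Π_{t=m}^{m+k} g_t ≤ F_m ≤ 1∕(m+1)` and source `e_q∕Γ_q ≥ 0`; §2 **THE UNIVERSAL INTEGRATED END ALONG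
# EVERY FLOW**: for EVERY profile `L ≥ 0` (no age `0`), EVERY admissible flow, EVERY damping `0 < g ≤ 1` (no self-consistency), EVERY horizon and EVERY
# `e ≥ 0` (no monotonicity): `0 ≤ e_m∕Γ_m ≤ Σ_{q=m}^{N} ε_q∕Γ_q ≤ Σ_{q=m}^{N} e_q∕Γ_q` at every pin (`flow_tail_weighted_nonneg_le`); undamped:
# `0 ≤ e_m ≤ Σ_{q=m}^{N} ε_q ≤ Σ_{q=m}^{N} e_q` (`flow_tail_nonneg_le`) — the first statement of route (N) quantified over ALL profiles with no load
# hypothesis; §3 THE VISIT CRITERION ALONG UNDAMPED FLOWS (`flow_nonneg_of_visits`): local visit supersolutions `ψ_{m,l}` of the flow's chain with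
# `Σ_l (KA 1 m l − KA 1 m (l+1))·ψ_{m,l}(m+1) ≤ 1` give `0 ≤ ε ≤ e` — (E86i)'s light-load criterion is the instance «every position visited»

Cell `pub-balaban`, β-function sub-cell, BINDER row D4 «RemainderConst leaves for Bałaban's split» (`HOME/BINDER-OWNERS.md`; owner lineage `b2b-balaban-beta-an4`;
this file by co-owner #2 lineage `b2b-balaban-beta-d4-p2`, generation 86), β-FLOW TEAM duty (1), FREEZE (0) honoured (def-free; imports (E91a) `…TwoAgesOldRead`
and (E98a) `…UpwardChain`; uses (E98a) `tail_nonneg_le` ∕ `renewal_nonneg_of_visits`, (E91a) `lagZero_le`, (E80b) `aggregate_eq_sum`, (E82a) `kernel_entry_le`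
BY NAME; nothing restated).

HONEST FRAMING (page 1, verbatim and binding).  *"Discharging BetaPertH makes Bałaban's UV stability UNCONDITIONAL — a real constructive-QFT result; it is
NOT the continuum limit and NOT the Clay problem."*  THIS FILE DISCHARGES NOTHING OF THE KIND.  Elementary real algebra ∕ real analysis about ABSTRACT
functionals on a box ]0,γ]^ℕ with displayed floors, profiles and signs, and the FIRST-ORDER renewal objects of route (N) built from them — hypotheses of a
census, not facts; the form, signs, ages and moments of Bałaban's (1.22) limit functional are NOT PRINTED ([I] p. 298; GAPS G-t4-U2-1∕-2) and NOT asserted.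
Row D4 class UNCHANGED (critical-path width 0; instance 0∕1; D4 DISCHARGE NO DATE).  HONEST DEPENDENCY: continuum YM on T⁴ ⇐ BetaPertH ∧ nine spine
estimates (0/9 proved); BetaPertH ⇐ (D1) ∧ (D4) ∧ CAP+tail; G-an2-4 gates asym, D1 and NE2/3/4.

THE POINT (README `HOME/b2b-balaban-beta-d4-p2/g86/README.md`).  The flow's damped kernel `KL k n l = c_k(n)·Π_{t=n+1+l}^{n+k} g_t` (`c_k(n) = L_kh_{n+k}³∕2`)
has `KL k n l·Γ_{n+1+l} = c_k(n)·Γ_{n+k+1}` for `l < k`, so `Γ_{n+1+l}·KA 1 n l = Σ_{k>l} c_k(n)Γ_{n+k+1}` is a TAIL in the lag and `A′_n(l) := KA 1 n l·Γ_{n+1+l}∕Γ_n`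
is a tail kernel with `A′_n(0) ≤ Σ_{k≥1} c_k(n) = F_n ≤ 1∕(n+1)` ((E91a) `lagZero_le`); dividing `ε_n = e_n − Σ_l KA 1 n l·ε_{n+1+l}` by `Γ_n` gives the
tail-kernel system for `y = ε∕Γ` with source `e∕Γ ≥ 0`, and (E98a) `tail_nonneg_le` applies: the `Γ`-weighted tail sums of the surplus are non-negative
and below those of the excess — for every profile whatsoever.  (Pointwise the END may fail for arbitrary dampings `g ∈ ]0,1]` at astronomically large
ages — README g82 §3; the integrated statement does not.)  Undamped (`g ≡ 1`, `Γ ≡ 1`) the aggregate kernel is itself a tail kernel and the visit criterion of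
(E98a) applies verbatim (§3).  NOT CLAIMED: the pointwise END for any new class of profiles; anything nonlinear; anything printed — NOT B12 Thm 2, NOT
BetaPertH, NOT continuum, NOT Clay.

WHAT IS PROVED ([folklore]; 0 `def`, 0 sorry).  §1 `aggregate_one_eq`, `kernel_mul_weight`, **`weighted_aggregate_tail`** (tail form, monotonicity, vanishing,
`A′_n(0) ≤ 1∕(n+1)`).  §2 **`flow_tail_weighted_nonneg_le`**, **`flow_tail_nonneg_le`**.  §3 `aggregate_undamped_tail`, **`flow_nonneg_of_visits`**.
-/
noncomputable section
open Finset

namespace Summit.QuantumFields.BalabanUV.Beta.EriceRemainderEnclosureHistoryAutonomyComparisonAgeCompositionUpwardChainFlow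

open Literature.MathematicalPhysics.QuantumFieldTheory.Balaban1983to89
open Literature.MathematicalPhysics.QuantumFieldTheory.Balaban1983to89.T4BetaStationary
open Literature.MathematicalPhysics.QuantumFieldTheory.Balaban1983to89.T4BetaFlowWellPosed
open Summit.QuantumFields.BalabanUV.Beta.EriceRemainderEnclosureHistoryAutonomyComparisonAgeCompositionTwoAgesOldRead (lagZero_le)
open Summit.QuantumFields.BalabanUV.Beta.EriceRemainderEnclosureHistoryAutonomyComparisonAgeCompositionYoungestTailSumFlow (kernel_entry_le)
open Summit.QuantumFields.BalabanUV.Beta.EriceRemainderEnclosureHistoryAutonomyComparisonAgeCompositionChainWiring (aggregate_eq_sum)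
open Summit.QuantumFields.BalabanUV.Beta.EriceRemainderEnclosureHistoryAutonomyComparisonAgeCompositionUpwardChain
  (tail_nonneg_le renewal_nonneg_of_visits)

variable {B : (ℕ → ℝ) → ℝ} {γ b gIR : ℝ} {L : ℕ → ℝ} {K : ℕ} {h g : ℕ → ℝ}

/-! ## §1 The damped aggregate kernel in tail form -/

/-- The aggregate kernel from the age `1` is the sum of the age kernels (also when `K = 0`). [folklore] -/
theorem aggregate_one_eq {KL KA : ℕ → ℕ → ℕ → ℝ}
    (hKL : ∀ k n l, KL k n l = if 0 < k ∧ k < K ∧ l < k then L k * h (n + k) ^ 3 / 2 * ∏ t ∈ Ico (n + 1 + l) (n + k + 1), g t else 0)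
    (hKA : ∀ i m l, KA i m l = KL i m l + KA (i + 1) m l) (hKAtop : ∀ m l, KA K m l = 0) (m l : ℕ) :
    KA 1 m l = ∑ k ∈ Ico 1 K, KL k m l := by
  rcases Nat.eq_zero_or_pos K with hK | hK
  · subst hK
    have h0 := hKA 0 m l
    rw [hKAtop, hKL] at h0
    simp only [lt_self_iff_false, false_and, if_false, zero_add] at h0
    rw [← h0]; simp
  · obtain ⟨n, rfl⟩ : ∃ n, K = n + 1 := ⟨K - 1, by omega⟩
    exact aggregate_eq_sum hKA hKAtop (by omega) m l

/-- The damping weights absorb the kernel's products: `KL k n l·Γ_{n+1+l} = [0<k<K, l<k]·c_k(n)·Γ_{n+k+1}`, `Γ_q = Π_{t<q} g_t`. [folklore] -/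
theorem kernel_mul_weight {KL : ℕ → ℕ → ℕ → ℝ} {Γ : ℕ → ℝ}
    (hKL : ∀ k n l, KL k n l = if 0 < k ∧ k < K ∧ l < k then L k * h (n + k) ^ 3 / 2 * ∏ t ∈ Ico (n + 1 + l) (n + k + 1), g t else 0)
    (hΓ : ∀ q, Γ q = ∏ t ∈ range q, g t) (k n l : ℕ) :
    KL k n l * Γ (n + 1 + l) = if 0 < k ∧ k < K ∧ l < k then L k * h (n + k) ^ 3 / 2 * Γ (n + k + 1) else 0 := by
  rw [hKL]
  split_ifs with hc
  · rw [hΓ, hΓ, ← prod_range_mul_prod_Ico g (show n + 1 + l ≤ n + k + 1 by omega)]; ring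
  · rw [zero_mul]

/-- **THE DAMPED AGGREGATE KERNEL IN TAIL FORM.**  Along every flow (isotone memory with floor `b > 0` dominating `L ≥ 0`, `L_0 = 0`), for every damping
`0 < g ≤ 1` with weights `Γ_q = Π_{t<q} g_t`, the kernel `A′_n(l) = KA 1 n l·Γ_{n+1+l}∕Γ_n` is a TAIL kernel: non-increasing in the lag, zero from the lag
`K` on, non-negative, and `A′_n(0) ≤ F_n = Σ_k L_kh_{n+k}³∕2 ≤ 1∕(n+1)` ((E91a) `lagZero_le`). [folklore] -/
theorem weighted_aggregate_tail (hmono : ∀ u v : ℕ → ℝ, SeqBox γ u → SeqBox γ v → (∀ j, u j ≤ v j) → B u ≤ B v)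
    (hL : ∀ k, 0 ≤ L k) (hb : 0 < b) (hlo : ∀ u, SeqBox γ u → b ≤ B u) (hdom : ∀ u, SeqBox γ u → ∑ k ∈ range K, L k * u k ≤ B u)
    (hh : SeqBox γ h) (hf : MemFlow B gIR h) (hL0 : L 0 = 0) (hg : ∀ t, 0 < g t ∧ g t ≤ 1)
    {KL : ℕ → ℕ → ℕ → ℝ}
    (hKL : ∀ k n l, KL k n l = if 0 < k ∧ k < K ∧ l < k then L k * h (n + k) ^ 3 / 2 * ∏ t ∈ Ico (n + 1 + l) (n + k + 1), g t else 0)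
    {KA : ℕ → ℕ → ℕ → ℝ} (hKA : ∀ i m l, KA i m l = KL i m l + KA (i + 1) m l) (hKAtop : ∀ m l, KA K m l = 0)
    {Γ : ℕ → ℝ} (hΓ : ∀ q, Γ q = ∏ t ∈ range q, g t)
    {A : ℕ → ℕ → ℝ} (hA : ∀ n l, A n l = KA 1 n l * Γ (n + 1 + l) / Γ n) :
    (∀ n l, A n (l + 1) ≤ A n l) ∧ (∀ n l, K ≤ l → A n l = 0) ∧ (∀ n l, 0 ≤ A n l) ∧
      (∀ n, A n 0 ≤ 1 / ((n : ℝ) + 1)) := by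
  have hpos : ∀ n, 0 < h n := fun n => (hh n).1
  have hΓpos : ∀ q, 0 < Γ q := fun q => by rw [hΓ]; exact prod_pos fun t _ => (hg t).1
  have hc0 : ∀ k n, 0 ≤ L k * h (n + k) ^ 3 / 2 := fun k n => by have := hL k; have := hpos (n + k); positivity
  -- the weighted kernel entries
  obtain ⟨W, hW⟩ : ∃ W : ℕ → ℕ → ℕ → ℝ, ∀ k n l,
      W k n l = if 0 < k ∧ k < K ∧ l < k then L k * h (n + k) ^ 3 / 2 * Γ (n + k + 1) else 0 := ⟨_, fun _ _ _ => rfl⟩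
  have hAW : ∀ n l, A n l = (∑ k ∈ Ico 1 K, W k n l) / Γ n := by
    intro n l
    rw [hA, aggregate_one_eq hKL hKA hKAtop, sum_mul]
    congr 1
    exact sum_congr rfl fun k _ => by rw [hW, kernel_mul_weight hKL hΓ]
  have hW0 : ∀ k n l, 0 ≤ W k n l := fun k n l => by
    rw [hW]; split_ifs
    · exact mul_nonneg (hc0 k n) (hΓpos _).le
    · exact le_rfl
  have hWanti : ∀ k n l, W k n (l + 1) ≤ W k n l := by
    intro k n l
    by_cases h1 : 0 < k ∧ k < K ∧ l + 1 < k
    · rw [hW, hW, if_pos h1, if_pos ⟨h1.1, h1.2.1, by omega⟩]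
    · rw [hW k n (l + 1), if_neg h1]; exact hW0 k n l
  refine ⟨fun n l => ?_, fun n l hl => ?_, fun n l => ?_, fun n => ?_⟩
  · rw [hAW, hAW]
    exact div_le_div_of_nonneg_right (sum_le_sum fun k _ => hWanti k n l) (hΓpos n).le
  · rw [hAW]
    have : ∑ k ∈ Ico 1 K, W k n l = 0 :=
      sum_eq_zero fun k hk => by rw [hW, if_neg (fun hc => by have := (mem_Ico.mp hk).2; omega)]
    rw [this, zero_div]
  · rw [hAW]; exact div_nonneg (sum_nonneg fun k _ => hW0 k n l) (hΓpos n).le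
  · -- A n 0 ≤ Σ_{k ∈ Ico 1 K} c_k(n) ≤ F_n ≤ 1/(n+1)
    have hF := lagZero_le hmono hL hb hlo hdom hh hf hL0 n
    have hratio : ∀ k, Γ (n + k + 1) / Γ n ≤ 1 := by
      intro k
      rw [div_le_one (hΓpos n), hΓ, hΓ, ← prod_range_mul_prod_Ico g (show n ≤ n + k + 1 by omega)]
      exact mul_le_of_le_one_right (prod_nonneg fun t _ => (hg t).1.le)
        (prod_le_one (fun t _ => (hg t).1.le) fun t _ => (hg t).2)
    have h1 : A n 0 ≤ ∑ k ∈ Ico 1 K, L k * h (n + k) ^ 3 / 2 := by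
      rw [hAW, sum_div]
      refine sum_le_sum fun k hk => ?_
      rw [hW]
      split_ifs with hc
      · rw [mul_div_assoc]; exact mul_le_of_le_one_right (hc0 k n) (hratio k)
      · exact div_nonpos_of_nonpos_of_nonneg le_rfl (hΓpos n).le |>.trans (hc0 k n)
    have h2 : ∑ k ∈ Ico 1 K, L k * h (n + k) ^ 3 / 2 ≤ ∑ k ∈ range K, L k * h (n + k) ^ 3 / 2 :=
      sum_le_sum_of_subset_of_nonneg (fun k hk => mem_range.mpr (mem_Ico.mp hk).2) fun k _ _ => hc0 k n
    exact h1.trans (h2.trans hF)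

/-! ## §2 The universal integrated END along every flow -/

/-- **THE UNIVERSAL INTEGRATED END ALONG EVERY FLOW (weighted form, every damping).**  `B` isotone on the box with floor `b > 0` dominating the profile
`L ≥ 0` (`L_0 = 0`), `h` a box solution of the flow, ANY damping `0 < g ≤ 1` (weights `Γ_q = Π_{t<q} g_t`), ANY horizon `N`, ANY `e ≥ 0`; the first-order
objects of route (N) (damped kernel `KL`, aggregate `KA`, reads `RA`, zero-tailed solution `ε = e − RA 1 ε`).  Then at EVERY pin `m`:
`0 ≤ e_m∕Γ_m ≤ Σ_{q=m}^{N} ε_q∕Γ_q ≤ Σ_{q=m}^{N} e_q∕Γ_q` — for EVERY profile, with no load, separation or monotonicity hypothesis.  ((E98a) `tail_nonneg_le` for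
`y = ε∕Γ`.) [folklore] -/
theorem flow_tail_weighted_nonneg_le (hmono : ∀ u v : ℕ → ℝ, SeqBox γ u → SeqBox γ v → (∀ j, u j ≤ v j) → B u ≤ B v)
    (hL : ∀ k, 0 ≤ L k) (hb : 0 < b) (hlo : ∀ u, SeqBox γ u → b ≤ B u) (hdom : ∀ u, SeqBox γ u → ∑ k ∈ range K, L k * u k ≤ B u)
    (hh : SeqBox γ h) (hf : MemFlow B gIR h) (hL0 : L 0 = 0) (hg : ∀ t, 0 < g t ∧ g t ≤ 1)
    {N : ℕ} {KL : ℕ → ℕ → ℕ → ℝ}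
    (hKL : ∀ k n l, KL k n l = if 0 < k ∧ k < K ∧ l < k then L k * h (n + k) ^ 3 / 2 * ∏ t ∈ Ico (n + 1 + l) (n + k + 1), g t else 0)
    {KA : ℕ → ℕ → ℕ → ℝ} {RA : ℕ → (ℕ → ℝ) → ℕ → ℝ}
    (hRA : ∀ i v m, RA i v m = ∑ l ∈ range K, KA i m l * v (m + 1 + l))
    (hKA : ∀ i m l, KA i m l = KL i m l + KA (i + 1) m l) (hKAtop : ∀ m l, KA K m l = 0)
    {Γ : ℕ → ℝ} (hΓ : ∀ q, Γ q = ∏ t ∈ range q, g t)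
    {e ε : ℕ → ℝ} (he0 : ∀ m, 0 ≤ e m) (hεt : ∀ m, N < m → ε m = 0) (hεrec : ∀ m, ε m = e m - RA 1 ε m) (m : ℕ) :
    0 ≤ ∑ q ∈ Ico m (N + 1), ε q / Γ q ∧ e m / Γ m ≤ ∑ q ∈ Ico m (N + 1), ε q / Γ q ∧
      ∑ q ∈ Ico m (N + 1), ε q / Γ q ≤ ∑ q ∈ Ico m (N + 1), e q / Γ q := by
  have hΓpos : ∀ q, 0 < Γ q := fun q => by rw [hΓ]; exact prod_pos fun t _ => (hg t).1
  obtain ⟨A, hA⟩ : ∃ A : ℕ → ℕ → ℝ, ∀ n l, A n l = KA 1 n l * Γ (n + 1 + l) / Γ n := ⟨_, fun _ _ => rfl⟩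
  obtain ⟨hanti, htop, -, hA0⟩ := weighted_aggregate_tail hmono hL hb hlo hdom hh hf hL0 hg hKL hKA hKAtop hΓ hA
  have hA1 : ∀ n, A n 0 ≤ 1 := fun n => (hA0 n).trans (by
    rw [div_le_one (by positivity)]; have : (0 : ℝ) ≤ n := Nat.cast_nonneg n; linarith)
  obtain ⟨R, hR⟩ : ∃ R : (ℕ → ℝ) → ℕ → ℝ, ∀ v n, R v n = ∑ l ∈ range K, A n l * v (n + 1 + l) := ⟨_, fun _ _ => rfl⟩
  -- the system for y = ε / Γ
  have hrec' : ∀ n, (fun q => ε q / Γ q) n = (fun q => e q / Γ q) n - R (fun q => ε q / Γ q) n := by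
    intro n
    have hΓn := hΓpos n
    simp only
    rw [hR, hεrec n, hRA, sub_div, sum_div]
    congr 1
    refine sum_congr rfl fun l _ => ?_
    rw [hA]
    have := hΓpos (n + 1 + l)
    field_simp
  have hεt' : ∀ n, N < n → (fun q => ε q / Γ q) n = 0 := fun n hn => by simp only; rw [hεt n hn, zero_div]
  exact tail_nonneg_le (Kw := K) hanti htop hA1 hR (fun n => div_nonneg (he0 n) (hΓpos n).le) hεt' hrec' m

/-- **THE UNIVERSAL INTEGRATED END ALONG EVERY FLOW (undamped).**  As `flow_tail_weighted_nonneg_le` with `g ≡ 1`: for EVERY profile `L ≥ 0` (`L_0 = 0`),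
EVERY admissible flow, EVERY horizon and EVERY `e ≥ 0`, the undamped first-order surplus satisfies `0 ≤ e_m ≤ Σ_{q=m}^{N} ε_q ≤ Σ_{q=m}^{N} e_q` at every
pin: the surplus summed from any pin to the horizon is at least the excess at that pin and at most the summed excess, whatever the ages and the loads.
[folklore] -/
theorem flow_tail_nonneg_le (hmono : ∀ u v : ℕ → ℝ, SeqBox γ u → SeqBox γ v → (∀ j, u j ≤ v j) → B u ≤ B v)
    (hL : ∀ k, 0 ≤ L k) (hb : 0 < b) (hlo : ∀ u, SeqBox γ u → b ≤ B u) (hdom : ∀ u, SeqBox γ u → ∑ k ∈ range K, L k * u k ≤ B u)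
    (hh : SeqBox γ h) (hf : MemFlow B gIR h) (hL0 : L 0 = 0)
    {N : ℕ} {KL : ℕ → ℕ → ℕ → ℝ}
    (hKL : ∀ k n l, KL k n l = if 0 < k ∧ k < K ∧ l < k then L k * h (n + k) ^ 3 / 2 else 0)
    {KA : ℕ → ℕ → ℕ → ℝ} {RA : ℕ → (ℕ → ℝ) → ℕ → ℝ}
    (hRA : ∀ i v m, RA i v m = ∑ l ∈ range K, KA i m l * v (m + 1 + l))
    (hKA : ∀ i m l, KA i m l = KL i m l + KA (i + 1) m l) (hKAtop : ∀ m l, KA K m l = 0)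
    {e ε : ℕ → ℝ} (he0 : ∀ m, 0 ≤ e m) (hεt : ∀ m, N < m → ε m = 0) (hεrec : ∀ m, ε m = e m - RA 1 ε m) (m : ℕ) :
    0 ≤ ∑ q ∈ Ico m (N + 1), ε q ∧ e m ≤ ∑ q ∈ Ico m (N + 1), ε q ∧ ∑ q ∈ Ico m (N + 1), ε q ≤ ∑ q ∈ Ico m (N + 1), e q := by
  have hKL' : ∀ k n l, KL k n l = if 0 < k ∧ k < K ∧ l < k
      then L k * h (n + k) ^ 3 / 2 * ∏ t ∈ Ico (n + 1 + l) (n + k + 1), (fun _ : ℕ => (1 : ℝ)) t else 0 := by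
    intro k n l; rw [hKL, prod_const_one, mul_one]
  have hΓ : ∀ q, (fun _ : ℕ => (1 : ℝ)) q = ∏ t ∈ range q, (fun _ : ℕ => (1 : ℝ)) t := fun q => by rw [prod_const_one]
  have key := flow_tail_weighted_nonneg_le hmono hL hb hlo hdom hh hf hL0 (g := fun _ => 1) (fun _ => ⟨one_pos, le_rfl⟩)
    hKL' hRA hKA hKAtop hΓ he0 hεt hεrec m
  simpa using key

/-! ## §3 The visit criterion along undamped flows -/

/-- **THE UNDAMPED AGGREGATE KERNEL IS A TAIL KERNEL.**  Along every flow (`L ≥ 0`, `L_0 = 0`), undamped: `KA 1 n (l+1) ≤ KA 1 n l`, `KA 1 n l = 0` for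
`l ≥ K`, and `KA 1 n 0 ≤ F_n ≤ 1∕(n+1)`; the drop at the lag `l` is the per-target weight of the age `l+1`:
`KA 1 n l − KA 1 n (l+1) = [l+1 < K]·L_{l+1}h_{n+l+1}³∕2`. [folklore] -/
theorem aggregate_undamped_tail (hmono : ∀ u v : ℕ → ℝ, SeqBox γ u → SeqBox γ v → (∀ j, u j ≤ v j) → B u ≤ B v)
    (hL : ∀ k, 0 ≤ L k) (hb : 0 < b) (hlo : ∀ u, SeqBox γ u → b ≤ B u) (hdom : ∀ u, SeqBox γ u → ∑ k ∈ range K, L k * u k ≤ B u)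
    (hh : SeqBox γ h) (hf : MemFlow B gIR h) (hL0 : L 0 = 0)
    {KL : ℕ → ℕ → ℕ → ℝ} (hKL : ∀ k n l, KL k n l = if 0 < k ∧ k < K ∧ l < k then L k * h (n + k) ^ 3 / 2 else 0)
    {KA : ℕ → ℕ → ℕ → ℝ} (hKA : ∀ i m l, KA i m l = KL i m l + KA (i + 1) m l) (hKAtop : ∀ m l, KA K m l = 0) :
    (∀ n l, KA 1 n (l + 1) ≤ KA 1 n l) ∧ (∀ n l, K ≤ l → KA 1 n l = 0) ∧ (∀ n, KA 1 n 0 ≤ 1 / ((n : ℝ) + 1)) ∧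
      (∀ n l, KA 1 n l - KA 1 n (l + 1) = if l + 1 < K then L (l + 1) * h (n + (l + 1)) ^ 3 / 2 else 0) := by
  have hKL' : ∀ k n l, KL k n l = if 0 < k ∧ k < K ∧ l < k
      then L k * h (n + k) ^ 3 / 2 * ∏ t ∈ Ico (n + 1 + l) (n + k + 1), (fun _ : ℕ => (1 : ℝ)) t else 0 := by
    intro k n l; rw [hKL, prod_const_one, mul_one]
  have hΓ : ∀ q, (fun _ : ℕ => (1 : ℝ)) q = ∏ t ∈ range q, (fun _ : ℕ => (1 : ℝ)) t := fun q => by rw [prod_const_one]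
  have hA : ∀ n l, KA 1 n l = KA 1 n l * (fun _ : ℕ => (1 : ℝ)) (n + 1 + l) / (fun _ : ℕ => (1 : ℝ)) n := fun n l => by simp
  obtain ⟨hanti, htop, -, hA0⟩ := weighted_aggregate_tail hmono hL hb hlo hdom hh hf hL0 (g := fun _ => 1)
    (fun _ => ⟨one_pos, le_rfl⟩) hKL' hKA hKAtop hΓ hA
  refine ⟨hanti, htop, hA0, fun n l => ?_⟩
  rw [aggregate_one_eq hKL' hKA hKAtop, aggregate_one_eq hKL' hKA hKAtop, ← sum_sub_distrib]
  have hterm : ∀ k ∈ Ico 1 K, KL k n l - KL k n (l + 1) = if k = l + 1 then L (l + 1) * h (n + (l + 1)) ^ 3 / 2 else 0 := by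
    intro k hk
    have hk' := mem_Ico.mp hk
    rw [hKL, hKL]
    by_cases hkl : k = l + 1
    · subst hkl; rw [if_pos ⟨hk'.1, hk'.2, by omega⟩, if_neg (by omega), if_pos rfl, sub_zero]
    · rw [if_neg hkl]
      by_cases hlk : l + 1 < k
      · rw [if_pos ⟨hk'.1, hk'.2, by omega⟩, if_pos ⟨hk'.1, hk'.2, hlk⟩, sub_self]
      · rw [if_neg (fun hc => by omega), if_neg (fun hc => by omega), sub_self]
  rw [sum_congr rfl hterm, sum_ite_eq' (Ico 1 K) (l + 1)]
  by_cases hl : l + 1 < K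
  · rw [if_pos (mem_Ico.mpr ⟨by omega, hl⟩), if_pos hl]
  · rw [if_neg (fun hm => hl (mem_Ico.mp hm).2), if_neg hl]

/-- **THE VISIT CRITERION ALONG UNDAMPED FLOWS.**  `B` isotone with floor `b > 0` dominating `L ≥ 0` (`L_0 = 0`), `h` a box solution, undamped first-order
objects of route (N), `e ≥ 0` non-increasing, any horizon.  If for every pin `m` and every lag `l < K` a local visit supersolution `ψ_{m,l} ≥ 0` of the
flow's upward chain on the window `[m+1, m+2+l)` of the age `l+1` is given (`= 0` from `m+2+l` on;
`1 + (1 − KA 1 q 0)·ψ(q+1) + Σ_i (KA 1 q i − KA 1 q (i+1))·ψ(q+2+i) ≤ ψ(q)` inside), and `Σ_{l<K} (KA 1 m l − KA 1 m (l+1))·ψ_{m,l}(m+1) ≤ 1` — i.e.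
`Σ_k (L_kh_{m+k}³∕2)·ψ_{m,k−1}(m+1) ≤ 1` by `aggregate_undamped_tail` —, then `0 ≤ ε ≤ e` at every pin.  With `ψ_{m,l}(q) = m+2+l−q` this is (E86i)'s
light-load criterion `Σ_k x_k(m) ≤ 1`; sharper supersolutions discount each age's load by the younger ages' jumps inside its window ((E98a) §4). [folklore] -/
theorem flow_nonneg_of_visits (hmono : ∀ u v : ℕ → ℝ, SeqBox γ u → SeqBox γ v → (∀ j, u j ≤ v j) → B u ≤ B v)
    (hL : ∀ k, 0 ≤ L k) (hb : 0 < b) (hlo : ∀ u, SeqBox γ u → b ≤ B u) (hdom : ∀ u, SeqBox γ u → ∑ k ∈ range K, L k * u k ≤ B u)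
    (hh : SeqBox γ h) (hf : MemFlow B gIR h) (hL0 : L 0 = 0)
    {N : ℕ} {KL : ℕ → ℕ → ℕ → ℝ} (hKL : ∀ k n l, KL k n l = if 0 < k ∧ k < K ∧ l < k then L k * h (n + k) ^ 3 / 2 else 0)
    {KA : ℕ → ℕ → ℕ → ℝ} {RA : ℕ → (ℕ → ℝ) → ℕ → ℝ}
    (hRA : ∀ i v m, RA i v m = ∑ l ∈ range K, KA i m l * v (m + 1 + l))
    (hKA : ∀ i m l, KA i m l = KL i m l + KA (i + 1) m l) (hKAtop : ∀ m l, KA K m l = 0)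
    {e ε : ℕ → ℝ} (he0 : ∀ m, 0 ≤ e m) (hea : ∀ m, e (m + 1) ≤ e m)
    (hεt : ∀ m, N < m → ε m = 0) (hεrec : ∀ m, ε m = e m - RA 1 ε m)
    {ψ : ℕ → ℕ → ℕ → ℝ} (hψ0 : ∀ m l q, 0 ≤ ψ m l q) (hψoff : ∀ m l q, m + 2 + l ≤ q → ψ m l q = 0)
    (hψ : ∀ m l q, l < K → m + 1 ≤ q → q < m + 2 + l →
      1 + (1 - KA 1 q 0) * ψ m l (q + 1) + ∑ i ∈ range K, (KA 1 q i - KA 1 q (i + 1)) * ψ m l (q + 2 + i) ≤ ψ m l q)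
    (hcrit : ∀ m, ∑ l ∈ range K, (KA 1 m l - KA 1 m (l + 1)) * ψ m l (m + 1) ≤ 1) : ∀ m, 0 ≤ ε m ∧ ε m ≤ e m := by
  obtain ⟨hanti, htop, hA0, -⟩ := aggregate_undamped_tail hmono hL hb hlo hdom hh hf hL0 hKL hKA hKAtop
  have hA1 : ∀ n, KA 1 n 0 ≤ 1 := fun n => (hA0 n).trans (by
    rw [div_le_one (by positivity)]; have : (0 : ℝ) ≤ n := Nat.cast_nonneg n; linarith)
  exact renewal_nonneg_of_visits (Kw := K) (A := fun n l => KA 1 n l) (R := RA 1) hanti htop hA1 (hRA 1) he0 hea hεt hεrec hψ0 hψoff hψ hcrit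

end Summit.QuantumFields.BalabanUV.Beta.EriceRemainderEnclosureHistoryAutonomyComparisonAgeCompositionUpwardChainFlow
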